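/-
Width seat `ym-line-cbag-p1-w3` (prover-ym-line-cbag-p1-w3-g4-0), route `ColdBoxAllGroups` (planner-of-record ym-idea-2), glue for the
CLOSED crux `BoxFloorAllGroups` (stmt-QuantumFields-22254): the INFINITE-VOLUME reading of PW-CORR-POLY(G) — a power-law floor under the
plaquette two-point function of every torus-limit state, for every compact simple gauge group.  RECORD-label rung material only (R2xi-G);
the Yang–Mills mass gap is NOT proved by anything here.
-/
import Summits.QuantumFields.YangMills.Theorems.ColdBoxAllGroupsTorusPlaquetteFloor

/-!
# Route `ColdBoxAllGroups`, glue: the plaquette two-point floor in every infinite-volume torus-limit state, every compact simple `G`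

`ColdBoxAllGroupsTorusPlaquetteFloor` records PW-CORR-POLY(G) (`torusPlaquetteFloor_allGroups`): a floor `κ β^{-(2+8A)}` under the
connected two-point function of the spatial `(1,2)`-plaquette cost and its time-translate by `⌈β^A⌉`, on all large TORI, uniformly in the
volume.  The rates route reads such floors only through the RP-spectral gap (`massGapUpperRateOf_of_uniformTorusPlaquetteCorr`, whose proof
passes the floor to the limit states inline).  This file isolates that passage as a lemma and states the infinite-volume floor by name:

* `rpCorr_ge_of_uniformTorusPlaquetteCorr` (any `d`, any continuous `ρ`, spatial plane `i, j ≠ 0`): PW-CORR(T, δ) on the tori gives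
  `δ(β) ≤ rpCorr μ (plaqCost0 ρ i j) (T β)` for EVERY infinite-volume torus-limit point `μ` at `β ≥ β₀` (weak convergence on the three
  bounded continuous cylinder observables `c_p`, `c_p ∘ α_T`, `c_p · (c_p ∘ α_T)`; `θ`-invariance of the time-zero spatial plaquette);
* `rpCorr_plaqCost0_eq_cov`: for the spatial plaquette cost the RP correlator IS the plain connected two-point function
  `∫ c_p · (c_p ∘ α_t) dμ − ∫ c_p dμ · ∫ c_p ∘ α_t dμ`;
* `limitStatePlaquetteFloor_allGroups` — **for every compact simple `G` and faithful unitary lattice representation `r` there are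
  `A, κ > 0` and `β₀` such that for `β ≥ β₀` EVERY infinite-volume torus-limit state `μ` of the 4-D Wilson theory satisfies
  `κ β^{-(2+8A)} ≤ rpCorr μ (plaqCost0 r.ρ 1 2) ⌈β^A⌉₊`**: free-gluon-size plaquette correlations (`β² Cov ≍ n^{-8}` at separation `n = β^A`)
  survive in infinite volume for every compact simple gauge group — the quantity behind the rung leaf `XiPow`
  (`HasRPTimeGap.le_log_div` turns exactly this floor into the gap bound `m ≤ β^{-A/2}`).

HONEST FRAMING: lower bounds on correlations (upper bounds on gaps) only; nothing bears on the Clay mass gap; no summit statement is proved.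
No sorry; standard axioms.
-/

set_option autoImplicit false

noncomputable section

open MeasureTheory Filter Topology
open Literature.MathematicalPhysics.QuantumFieldTheory
open Literature.MathematicalPhysics.QuantumLattice
open Summit.QuantumFields.YangMills.Theorems.WeakCouplingRates

namespace Summit.QuantumFields.YangMills.Theorems.ColdBoxAllGroups

section General

variable {d N : ℕ} {G : Type*} [Group G] [TopologicalSpace G] [IsTopologicalGroup G] [CompactSpace G]
  [MeasurableSpace G] [BorelSpace G] (ρ : G →* Matrix (Fin N) (Fin N) ℂ)

omit [TopologicalSpace G] [IsTopologicalGroup G] [CompactSpace G] [BorelSpace G] in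
/-- For the spatial plaquette cost `c_p = plaqCost0 ρ i j` (`i, j ≠ 0`: a `θ`-invariant time-zero observable) the RP correlator at time `t` is
the plain connected two-point function `∫ c_p · (c_p ∘ α_t) dμ − ∫ c_p dμ · ∫ (c_p ∘ α_t) dμ`. -/
theorem rpCorr_plaqCost0_eq_cov [NeZero d] {i j : Fin d} (hi : i ≠ 0) (hj : j ≠ 0) (μ : Measure (LGConfig d G)) (t : ℕ) :
    rpCorr μ (plaqCost0 ρ i j) t =
      (∫ U, plaqCost0 ρ i j U * plaqCost0 ρ i j (timeShiftLG (G := G) t U) ∂μ) -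
        (∫ U, plaqCost0 ρ i j U ∂μ) * (∫ U, plaqCost0 ρ i j (timeShiftLG (G := G) t U) ∂μ) := by
  obtain ⟨hcyl, hS⟩ := plaqCost0_support (G := G) ρ hi hj
  have hrefl : ∀ U : LGConfig d G, plaqCost0 ρ i j (timeReflectLG U) = plaqCost0 ρ i j U :=
    comp_timeReflectLG_eq hcyl hS
  simp only [rpCorr, hrefl]

/-- **PW-CORR passes to every torus-limit state** (adapted from the inline argument of `massGapUpperRateOf_of_uniformTorusPlaquetteCorr`).
A volume-uniform lower bound `δ(β)` on the connected two-point function of the spatial `(i, j)`-plaquette cost at time separation `T(β)` on the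
tori `Λ_{L+1}` (`UniformTorusPlaquetteCorr d ρ i j T δ`) is, for `β ≥ β₀`, a lower bound on `rpCorr μ (plaqCost0 ρ i j) (T β)` for EVERY
infinite-volume torus-limit point `μ` (weak convergence of the torus states on bounded continuous cylinder observables). -/
theorem rpCorr_ge_of_uniformTorusPlaquetteCorr [NeZero d] (hρ : Continuous ρ) {i j : Fin d} (hi : i ≠ 0) (hj : j ≠ 0)
    {T : ℝ → ℕ} {δ : ℝ → ℝ} (h : UniformTorusPlaquetteCorr d ρ i j T δ) :
    ∃ β₀ : ℝ, ∀ β : ℝ, β₀ ≤ β → ∀ μ ∈ infiniteVolumeLimitPoints (d := d) ρ β,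
      δ β ≤ rpCorr μ (plaqCost0 ρ i j) (T β) := by
  obtain ⟨hcont, C, hC⟩ := continuous_bounded_plaqCost0 ρ hρ i j
  obtain ⟨hcyl, -⟩ := plaqCost0_support (G := G) ρ hi hj
  obtain ⟨β₀, hβ₀⟩ := h
  refine ⟨β₀, fun β hβ μ hμ => ?_⟩
  set F : LGConfig d G → ℝ := plaqCost0 ρ i j with hFdef
  obtain ⟨Lk, hmono, hprob, hlim⟩ := hμ
  have hcylG := isCylinder_timeShift hcyl (T β)
  have hcontG : Continuous fun U => F (timeShiftLG (G := G) (T β) U) :=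
    hcont.comp (continuous_timeShiftLG (T β))
  have hbdG : ∃ C, ∀ U : LGConfig d G, |F (timeShiftLG (G := G) (T β) U)| ≤ C := ⟨C, fun U => hC _⟩
  have hbdP : ∃ C', ∀ U : LGConfig d G, |F U * F (timeShiftLG (G := G) (T β) U)| ≤ C' :=
    ⟨C * C, fun U => by
      rw [abs_mul]
      exact mul_le_mul (hC _) (hC _) (abs_nonneg _) ((abs_nonneg _).trans (hC U))⟩
  have tF := hlim F _ hcyl hcont ⟨C, hC⟩
  have tG := hlim _ _ hcylG hcontG hbdG
  have tP := hlim _ _ (IsCylinder.mul hcyl hcylG) (hcont.mul hcontG) hbdP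
  have hev := hmono.tendsto_atTop.eventually (hβ₀ β hβ)
  have hcov : δ β ≤ (∫ U, F U * F (timeShiftLG (G := G) (T β) U) ∂μ) -
      (∫ U, F U ∂μ) * (∫ U, F (timeShiftLG (G := G) (T β) U) ∂μ) :=
    ge_of_tendsto (tP.sub (tF.mul tG)) hev
  rw [hFdef, rpCorr_plaqCost0_eq_cov ρ hi hj]
  exact hcov

/-- PW-CORR-POLY(A, κ) in infinite volume: `κ β^{-(2+8A)} ≤ rpCorr μ (plaqCost0 ρ i j) ⌈β^A⌉₊` for every torus-limit point `μ`, `β ≥ β₀`. -/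
theorem rpCorr_ge_of_polySeparationPlaquetteFloor (hρ : Continuous ρ) {i j : Fin 4} (hi : i ≠ 0) (hj : j ≠ 0) {A κ : ℝ}
    (h : PolySeparationPlaquetteFloor 4 ρ i j A κ) :
    ∃ β₀ : ℝ, ∀ β : ℝ, β₀ ≤ β → ∀ μ ∈ infiniteVolumeLimitPoints (d := 4) ρ β,
      κ * β ^ (-(2 + 8 * A)) ≤ rpCorr μ (plaqCost0 ρ i j) ⌈β ^ A⌉₊ :=
  rpCorr_ge_of_uniformTorusPlaquetteCorr ρ hρ hi hj h

end General

/-- **The plaquette two-point floor in every infinite-volume state, every compact simple `G`.**  For every compact simple `G` and every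
faithful unitary lattice representation `r` there are exponents `A, κ > 0` and a threshold `β₀` such that for all `β ≥ β₀` EVERY
infinite-volume torus-limit state `μ` of four-dimensional lattice Yang–Mills theory (Wilson action in `r`) has
`κ β^{-(2+8A)} ≤ rpCorr μ (plaqCost0 r.ρ 1 2) ⌈β^A⌉₊` — the connected correlator of the spatial plaquette cost `N − Re tr r(U_p)` with its
time-translate by `⌈β^A⌉` is at least a power of `β⁻¹` (free two-gluon size up to the constant).  PW-CORR-POLY(G)
(`torusPlaquetteFloor_allGroups`) passed to the limit states.  NOT the Clay gap (a lower bound on correlations). -/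
theorem limitStatePlaquetteFloor_allGroups :
    ∀ (G : Type) [Group G] [TopologicalSpace G] [IsTopologicalGroup G] [CompactSpace G],
      IsCompactSimpleLieGroup G →
      letI : MeasurableSpace G := borel G
      haveI : BorelSpace G := ⟨rfl⟩
      ∀ r : LatticeRep G, ∃ A κ β₀ : ℝ, 0 < A ∧ 0 < κ ∧ ∀ β : ℝ, β₀ ≤ β →
        ∀ μ ∈ infiniteVolumeLimitPoints (d := 4) r.ρ β,
          κ * β ^ (-(2 + 8 * A)) ≤ rpCorr μ (plaqCost0 r.ρ 1 2) ⌈β ^ A⌉₊ := by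
  intro G _ _ _ _ hG
  letI : MeasurableSpace G := borel G
  haveI : BorelSpace G := ⟨rfl⟩
  show ∀ r : LatticeRep G, ∃ A κ β₀ : ℝ, 0 < A ∧ 0 < κ ∧ ∀ β : ℝ, β₀ ≤ β →
    ∀ μ ∈ infiniteVolumeLimitPoints (d := 4) r.ρ β,
      κ * β ^ (-(2 + 8 * A)) ≤ rpCorr μ (plaqCost0 r.ρ 1 2) ⌈β ^ A⌉₊
  intro r
  have h : ∀ r : LatticeRep G, ∃ A κ : ℝ, 0 < A ∧ 0 < κ ∧ PolySeparationPlaquetteFloor 4 r.ρ 1 2 A κ :=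
    torusPlaquetteFloor_allGroups G hG
  obtain ⟨A, κ, hA, hκ, hfloor⟩ := h r
  obtain ⟨β₀, hβ₀⟩ := rpCorr_ge_of_polySeparationPlaquetteFloor r.ρ r.continuous (i := 1) (j := 2)
    (by decide) (by decide) hfloor
  exact ⟨A, κ, β₀, hA, hκ, hβ₀⟩

/-- The same under every exponent ceiling `θ₀ > 0` (`0 < A < θ₀`), from `torusPlaquetteFloor_allGroups_ceiling`.  NOT the Clay gap. -/
theorem limitStatePlaquetteFloor_allGroups_ceiling :
    ∀ (G : Type) [Group G] [TopologicalSpace G] [IsTopologicalGroup G] [CompactSpace G],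
      IsCompactSimpleLieGroup G →
      letI : MeasurableSpace G := borel G
      haveI : BorelSpace G := ⟨rfl⟩
      ∀ r : LatticeRep G, ∀ θ₀ : ℝ, 0 < θ₀ → ∃ A κ β₀ : ℝ, 0 < A ∧ A < θ₀ ∧ 0 < κ ∧ ∀ β : ℝ, β₀ ≤ β →
        ∀ μ ∈ infiniteVolumeLimitPoints (d := 4) r.ρ β,
          κ * β ^ (-(2 + 8 * A)) ≤ rpCorr μ (plaqCost0 r.ρ 1 2) ⌈β ^ A⌉₊ := by
  intro G _ _ _ _ hG
  letI : MeasurableSpace G := borel G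
  haveI : BorelSpace G := ⟨rfl⟩
  show ∀ r : LatticeRep G, ∀ θ₀ : ℝ, 0 < θ₀ → ∃ A κ β₀ : ℝ, 0 < A ∧ A < θ₀ ∧ 0 < κ ∧ ∀ β : ℝ, β₀ ≤ β →
    ∀ μ ∈ infiniteVolumeLimitPoints (d := 4) r.ρ β,
      κ * β ^ (-(2 + 8 * A)) ≤ rpCorr μ (plaqCost0 r.ρ 1 2) ⌈β ^ A⌉₊
  intro r θ₀ hθ₀
  have h : ∀ r : LatticeRep G, ∀ θ₀ : ℝ, 0 < θ₀ →
      ∃ A κ : ℝ, 0 < A ∧ A < θ₀ ∧ 0 < κ ∧ PolySeparationPlaquetteFloor 4 r.ρ 1 2 A κ :=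
    torusPlaquetteFloor_allGroups_ceiling G hG
  obtain ⟨A, κ, hA, hAθ, hκ, hfloor⟩ := h r θ₀ hθ₀
  obtain ⟨β₀, hβ₀⟩ := rpCorr_ge_of_polySeparationPlaquetteFloor r.ρ r.continuous (i := 1) (j := 2)
    (by decide) (by decide) hfloor
  exact ⟨A, κ, β₀, hA, hAθ, hκ, hβ₀⟩

end Summit.QuantumFields.YangMills.Theorems.ColdBoxAllGroups

end
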